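import Mathlib.Analysis.SpecialFunctions.Pow.Real
import Mathlib.Analysis.Convex.SpecificFunctions.Basic
import Literature.Barriers.CriticalPhenomena.WeaklySAWCouplingFlow
import HarnessLib

/-!
# The product formula of the perturbative flow: `∏_{k<n}(1 - γβ_kḡ_k)⁻¹ = (g₀/ḡ_n)^γ (c + O(ḡ_n))`
# (Bauerschmidt–Brydges–Slade 2015, §8.3; [BBS-rg-flow], Lemma 2.1(iii)(a))

Continuation of `WeaklySAWCouplingFlow.lean` (the recursion `ḡ_{j+1} = ḡ_j - β_jḡ_j²`, `GbarHyp`).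
The exponent `γ = 1/4` of the logarithmic correction in Theorem 1.1 of the source
(`CTWSAW.BBS2015_thm11` = `WeaklySAWFourDimLogCorrections`) enters the proof of Theorem 4.1 through
the `μ̌`-equation of the quadratic flow, `μ̄_{j+1} = L²μ̄_j(1 - γβ_jḡ_j) + …` (§6.1), whose
solution carries the product `Π_j = L^{2j}∏_{l<j}(1 - γβ_lǧ_l)`; the third lemma of §8.3
(`μ̌_j' = L^{2j}(ǧ_j/g₀)^γ(c + O(χ_jǧ_j))`) rests on the product formula stated before it,

  `∏_{k=j}^{l} (1 - γβ_kǧ_k)⁻¹ = (ǧ_j/ǧ_{l+1})^γ (c_j + O(χ_lḡ_l))`, `c_j = 1 + O(χ_jḡ_j)`,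

"a consequence of the recursion relation; its proof is identical to that of [BBS-rg-flow,
Lemma 2.1(iii)(a)] where the same statement is proved with `r_j = 0`". This file proves that
`r_j = 0` statement for `j = 0` (the case used in §8.3 and §8.5), for every `γ ∈ [0,1]`, with
explicit constants and without the `χ`-weights (which only sharpen the error terms beyond the
mass scale):
* `stepFactor γ t = (1 - t)^γ/(1 - γt)` (the factor `1 + r_k` of the printed proof, by
  "Taylor's theorem": `(1 - γβ_kḡ_k)⁻¹ = (1 - β_kḡ_k)^{-γ}(1 + r_k)`), with
  `1 - (16/9)γt² ≤ f_γ(t) ≤ 1` on `[0, 1/4]` (`one_sub_le_stepFactor`, `stepFactor_le_one`);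
* the exact identity `∏_{k<n}(1 - γβ_kḡ_k)⁻¹ = (g₀/ḡ_n)^γ P_n`, `P_n = ∏_{k<n} f_γ(β_kḡ_k)`
  (`GbarHyp.prod_inv_one_sub_eq`);
* `P_n` is non-increasing, `1 - (16/9)γB(g₀ - ḡ_n) ≤ P_n ≤ 1` (Weierstrass' product inequality and
  the telescoping `Σβ_kḡ_k² = g₀ - ḡ_n`), converges to `c = inf_n P_n ∈ [1 - (16/9)γBg₀, 1]`
  (`prodFactorLim_mem`: "`c = 1 + O(g₀)`"), and `P_n(1 - (16/9)γBḡ_n) ≤ c ≤ P_n`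
  (`prodFactor_mul_le_prodFactorLim`: "`c_{0,n} = c_0 + O(ḡ_n)`");
* the printed shape: `(g₀/ḡ_n)^γ c ≤ ∏_{k<n}(1 - γβ_kḡ_k)⁻¹ ≤ (g₀/ḡ_n)^γ c/(1 - (16/9)γBḡ_n)`
  (`GbarHyp.prod_inv_one_sub_mem`).

## References
* R. Bauerschmidt, D. C. Brydges, G. Slade, CMP 337 (2015), §6.1, §8.3 (product formula before the
  third lemma), §8.5. [BauerschmidtBrydgesSlade2015LogCorr]
* R. Bauerschmidt, D. C. Brydges, G. Slade, Ann. Henri Poincaré 16 (2015), Lemma 2.1(iii)(a) and its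
  proof. [BauerschmidtBrydgesSlade2015Flow]
-/

noncomputable section

open Filter Topology Finset
open scoped BigOperators

namespace Literature.Barriers.CriticalPhenomena

namespace CTWSAW

open Real in
/-- The per-step factor `f_γ(t) = (1 - t)^γ/(1 - γt)` of the product formula: by Taylor's theorem
`(1 - γβ_kḡ_k)⁻¹ = (1 - β_kḡ_k)^{-γ}(1 + r_k)`, `r_k = O(β_kḡ_k)²`, i.e. `1 + r_k = f_γ(β_kḡ_k)`.
[cite: BauerschmidtBrydgesSlade2015Flow, Lemma 2.1 (proof of (iii-a), first display)] -/
def stepFactor (γ t : ℝ) : ℝ := (1 - t) ^ γ / (1 - γ * t)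

/-- `(1 - γt) f_γ(t) = (1 - t)^γ` (`γt < 1`). [cite: BauerschmidtBrydgesSlade2015Flow, Lemma 2.1 (proof of (iii-a))] -/
theorem one_sub_mul_stepFactor {γ t : ℝ} (h : γ * t < 1) :
    (1 - γ * t) * stepFactor γ t = (1 - t) ^ γ := by
  unfold stepFactor
  rw [mul_div_cancel₀ _ (by linarith)]

/-- `f_γ(t) > 0` for `t < 1`, `γt < 1`. [folklore] -/
theorem stepFactor_pos {γ t : ℝ} (ht : t < 1) (h : γ * t < 1) : 0 < stepFactor γ t :=
  div_pos (Real.rpow_pos_of_pos (by linarith) _) (by linarith)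

/-- `f_γ(t) ≤ 1` for `0 ≤ t < 1`, `0 ≤ γ ≤ 1` (Bernoulli: `(1 - t)^γ ≤ 1 - γt`). [folklore] -/
theorem stepFactor_le_one {γ t : ℝ} (ht0 : 0 ≤ t) (ht : t < 1) (hγ0 : 0 ≤ γ) (hγ1 : γ ≤ 1) :
    stepFactor γ t ≤ 1 := by
  have hγt : γ * t < 1 := by nlinarith
  unfold stepFactor
  rw [div_le_one (by linarith)]
  have := rpow_one_add_le_one_add_mul_self (s := -t) (by linarith) hγ0 hγ1
  calc (1 - t) ^ γ = (1 + -t) ^ γ := by ring_nf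
    _ ≤ 1 + γ * -t := this
    _ = 1 - γ * t := by ring

/-- The second-order lower bound `1 - (16/9)γt² ≤ f_γ(t)` for `0 ≤ t ≤ 1/4`, `0 ≤ γ ≤ 1`
(from `(1 - t)^γ = e^{γ log(1-t)} ≥ 1 - γt/(1 - t)`), i.e. `r_k = O(β_kḡ_k)²` with an explicit constant.
[cite: BauerschmidtBrydgesSlade2015Flow, Lemma 2.1 (proof of (iii-a): r_k = O(β_kḡ_k)²)] -/
theorem one_sub_le_stepFactor {γ t : ℝ} (ht0 : 0 ≤ t) (ht : t ≤ 1 / 4) (hγ0 : 0 ≤ γ) (hγ1 : γ ≤ 1) :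
    1 - 16 / 9 * γ * t ^ 2 ≤ stepFactor γ t := by
  have h1t : 0 < 1 - t := by linarith
  have hγt : 0 < 1 - γ * t := by nlinarith
  -- (1 - t)^γ ≥ 1 - γ t/(1 - t)
  have hlog : -(t / (1 - t)) ≤ Real.log (1 - t) := by
    have := Real.log_le_sub_one_of_pos (inv_pos.2 h1t)
    rw [Real.log_inv] at this
    have h2 : (1 - t)⁻¹ - 1 = t / (1 - t) := by field_simp; ring
    linarith
  have hpow : 1 - γ * (t / (1 - t)) ≤ (1 - t) ^ γ := by
    rw [Real.rpow_def_of_pos h1t]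
    refine le_trans ?_ (Real.add_one_le_exp _)
    nlinarith [mul_le_mul_of_nonneg_left hlog hγ0]
  unfold stepFactor
  rw [le_div_iff₀ hγt]
  refine le_trans ?_ hpow
  -- (1 - 16/9 γ t²)(1 - γ t) ≤ 1 - γ t/(1-t)
  rw [show 1 - γ * (t / (1 - t)) = (1 - t - γ * t) / (1 - t) by field_simp, le_div_iff₀ h1t]
  -- reduces to γt² ≤ (16/9)γt²(1 - t)(1 - γt), i.e. 9/16 ≤ (1 - t)(1 - γt)
  have hγt' : γ * t ≤ 1 / 4 := by nlinarith
  have hA : 9 / 16 ≤ (1 - t) * (1 - γ * t) := by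
    nlinarith [mul_le_mul (show (3:ℝ) / 4 ≤ 1 - t by linarith) (show (3:ℝ) / 4 ≤ 1 - γ * t by linarith)
      (by norm_num) h1t.le]
  have key : γ * t ^ 2 * 1 ≤ γ * t ^ 2 * (16 / 9 * ((1 - t) * (1 - γ * t))) :=
    mul_le_mul_of_nonneg_left (by linarith) (mul_nonneg hγ0 (sq_nonneg t))
  nlinarith [key]

/-- Weierstrass' product inequality on `range n`: `1 - Σ_{k<n}(1 - r_k) ≤ ∏_{k<n} r_k` for
`0 ≤ r_k ≤ 1`. [folklore] -/
theorem one_sub_sum_range_le_prod (r : ℕ → ℝ) (n : ℕ) (h0 : ∀ k < n, 0 ≤ r k) (h1 : ∀ k < n, r k ≤ 1) :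
    1 - ∑ k ∈ range n, (1 - r k) ≤ ∏ k ∈ range n, r k := by
  induction n with
  | zero => simp
  | succ n ih =>
    rw [sum_range_succ, prod_range_succ]
    have hP0 : 0 ≤ ∏ k ∈ range n, r k := prod_nonneg fun k hk => h0 k (by
      have := mem_range.1 hk; omega)
    have hP1 : ∏ k ∈ range n, r k ≤ 1 := prod_le_one (fun k hk => h0 k (by
      have := mem_range.1 hk; omega)) fun k hk => h1 k (by have := mem_range.1 hk; omega)
    have hih := ih (fun k hk => h0 k (by omega)) fun k hk => h1 k (by omega)
    have ha0 := h0 n (by omega)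
    have ha1 := h1 n (by omega)
    nlinarith

/-- The correction product `P_n = P_n(β, g₀, γ) = ∏_{k<n} f_γ(β_kḡ_k)` (= `c_{0,n-1} = ∏_{k<n}(1 + r_k)`
of the source). [cite: BauerschmidtBrydgesSlade2015Flow, Lemma 2.1 (proof of (iii-a), c_{j,l})] -/
def prodFactor (β : ℕ → ℝ) (g₀ γ : ℝ) (n : ℕ) : ℝ :=
  ∏ k ∈ range n, stepFactor γ (β k * gbar β g₀ k)

/-- Its limit `c = lim_n P_n` (= `c_0` of the source), realised as `inf_n P_n` (`P` is non-increasing).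
[cite: BauerschmidtBrydgesSlade2015Flow, Lemma 2.1(iii)(a) (the constant c_j, j = 0)] -/
def prodFactorLim (β : ℕ → ℝ) (g₀ γ : ℝ) : ℝ :=
  ⨅ n, prodFactor β g₀ γ n

namespace GbarHyp

variable {β : ℕ → ℝ} {B g₀ γ : ℝ} (h : GbarHyp β B g₀)
include h

/-- `β_kḡ_k < 1` and `γβ_kḡ_k < 1` for `γ ≤ 1`. [folklore] -/
theorem gamma_mul_lt_one (hγ1 : γ ≤ 1) (k : ℕ) : γ * (β k * gbar β g₀ k) < 1 := by
  nlinarith [h.beta_mul_gbar_le k, h.beta_mul_gbar_nonneg k]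

/-- **The product formula, exact form** (`r = 0`, `j = 0`):
`∏_{k<n} (1 - γβ_kḡ_k)⁻¹ = (g₀/ḡ_n)^γ · P_n`.
[cite: BauerschmidtBrydgesSlade2015Flow, Lemma 2.1(iii)(a)]
[cite: BauerschmidtBrydgesSlade2015LogCorr, §8.3 (the product formula ∏(1 - γβ_kǧ_k)⁻¹ = (ǧ_j/ǧ_{l+1})^γ(c_j + O(χ_lḡ_l)), r = 0)] -/
theorem prod_inv_one_sub_eq (hγ1 : γ ≤ 1) (n : ℕ) :
    ∏ k ∈ range n, (1 - γ * (β k * gbar β g₀ k))⁻¹ =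
      (g₀ / gbar β g₀ n) ^ γ * prodFactor β g₀ γ n := by
  induction n with
  | zero => simp [prodFactor, div_self h.pos.ne']
  | succ n ih =>
    rw [prod_range_succ, ih]
    unfold prodFactor
    rw [prod_range_succ]
    set t := β n * gbar β g₀ n with ht
    have ht1 : γ * t < 1 := h.gamma_mul_lt_one hγ1 n
    have h1t : 0 < 1 - t := by have := h.one_sub_ge n; rw [← ht] at this; linarith
    have hgn := h.gbar_pos n
    have hgn1 := h.gbar_pos (n + 1)
    -- (g₀/ḡ_n)^γ = (g₀/ḡ_{n+1})^γ (1 - t)^γ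
    have key : (g₀ / gbar β g₀ n) ^ γ = (g₀ / gbar β g₀ (n + 1)) ^ γ * (1 - t) ^ γ := by
      rw [← Real.mul_rpow (div_pos h.pos hgn1).le h1t.le]
      congr 1
      rw [gbar_succ', ← ht]
      field_simp
    rw [key]
    have hf : stepFactor γ t = (1 - t) ^ γ / (1 - γ * t) := rfl
    rw [hf, div_eq_mul_inv]
    ring

/-- `0 < P_n`. [folklore] -/
theorem prodFactor_pos (hγ1 : γ ≤ 1) (n : ℕ) : 0 < prodFactor β g₀ γ n :=
  prod_pos fun k _ => stepFactor_pos (by linarith [h.beta_mul_gbar_le k]) (h.gamma_mul_lt_one hγ1 k)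

/-- `P_{n+1} ≤ P_n` (each factor is `≤ 1`). [cite: BauerschmidtBrydgesSlade2015Flow, Lemma 2.1(iii)(a)] -/
theorem prodFactor_succ_le (hγ0 : 0 ≤ γ) (hγ1 : γ ≤ 1) (n : ℕ) :
    prodFactor β g₀ γ (n + 1) ≤ prodFactor β g₀ γ n := by
  rw [prodFactor, prod_range_succ, ← prodFactor]
  refine mul_le_of_le_one_right (h.prodFactor_pos hγ1 n).le ?_
  exact stepFactor_le_one (h.beta_mul_gbar_nonneg n) (by linarith [h.beta_mul_gbar_le n]) hγ0 hγ1

/-- `P` is non-increasing. [cite: BauerschmidtBrydgesSlade2015Flow, Lemma 2.1(iii)(a)] -/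
theorem prodFactor_antitone (hγ0 : 0 ≤ γ) (hγ1 : γ ≤ 1) : Antitone (prodFactor β g₀ γ) :=
  antitone_nat_of_succ_le (h.prodFactor_succ_le hγ0 hγ1)

/-- `P_n ≤ 1`. [cite: BauerschmidtBrydgesSlade2015Flow, Lemma 2.1(iii)(a)] -/
theorem prodFactor_le_one (hγ0 : 0 ≤ γ) (hγ1 : γ ≤ 1) (n : ℕ) : prodFactor β g₀ γ n ≤ 1 := by
  simpa [prodFactor] using h.prodFactor_antitone hγ0 hγ1 (Nat.zero_le n)

/-- The one-step deficiency: `1 - f_γ(β_kḡ_k) ≤ (16/9)γB(ḡ_k - ḡ_{k+1})`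
(`(β_kḡ_k)² ≤ Bβ_kḡ_k² = B(ḡ_k - ḡ_{k+1})`). [cite: BauerschmidtBrydgesSlade2015Flow, Lemma 2.1 (proof of (iii-a): log(1 + r_k) = O(χ_kḡ_k²))] -/
theorem one_sub_stepFactor_le (hγ0 : 0 ≤ γ) (hγ1 : γ ≤ 1) (k : ℕ) :
    1 - stepFactor γ (β k * gbar β g₀ k) ≤
      16 / 9 * γ * B * (gbar β g₀ k - gbar β g₀ (k + 1)) := by
  have h1 := one_sub_le_stepFactor (h.beta_mul_gbar_nonneg k) (h.beta_mul_gbar_le k) hγ0 hγ1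
  have h2 : (β k * gbar β g₀ k) ^ 2 ≤ B * (gbar β g₀ k - gbar β g₀ (k + 1)) := by
    rw [gbar_succ]
    have : B * (gbar β g₀ k - (gbar β g₀ k - β k * gbar β g₀ k ^ 2)) = B * β k * gbar β g₀ k ^ 2 := by
      ring
    rw [this]
    nlinarith [h.beta_le k, h.beta_nonneg k, sq_nonneg (gbar β g₀ k),
      mul_nonneg (h.beta_nonneg k) (sq_nonneg (gbar β g₀ k))]
  nlinarith [mul_le_mul_of_nonneg_left h2 (by positivity : (0 : ℝ) ≤ 16 / 9 * γ)]

/-- **`1 - (16/9)γB(g₀ - ḡ_n) ≤ P_n`** (Weierstrass' inequality and telescoping), so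
`P_n = 1 + O(g₀)`. [cite: BauerschmidtBrydgesSlade2015Flow, Lemma 2.1(iii)(a) (c_j = 1 + O(χ_jḡ_j))] -/
theorem one_sub_le_prodFactor (hγ0 : 0 ≤ γ) (hγ1 : γ ≤ 1) (n : ℕ) :
    1 - 16 / 9 * γ * B * (g₀ - gbar β g₀ n) ≤ prodFactor β g₀ γ n := by
  have hW := one_sub_sum_range_le_prod (fun k => stepFactor γ (β k * gbar β g₀ k)) n
    (fun k _ => (stepFactor_pos (by linarith [h.beta_mul_gbar_le k]) (h.gamma_mul_lt_one hγ1 k)).le)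
    (fun k _ => stepFactor_le_one (h.beta_mul_gbar_nonneg k) (by linarith [h.beta_mul_gbar_le k]) hγ0 hγ1)
  refine le_trans ?_ hW
  have hsum : ∑ k ∈ range n, (1 - stepFactor γ (β k * gbar β g₀ k)) ≤
      16 / 9 * γ * B * (g₀ - gbar β g₀ n) := by
    calc ∑ k ∈ range n, (1 - stepFactor γ (β k * gbar β g₀ k))
        ≤ ∑ k ∈ range n, 16 / 9 * γ * B * (gbar β g₀ k - gbar β g₀ (k + 1)) :=
          sum_le_sum fun k _ => h.one_sub_stepFactor_le hγ0 hγ1 k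
      _ = 16 / 9 * γ * B * (g₀ - gbar β g₀ n) := by
          rw [← mul_sum, sum_range_sub' (fun k => gbar β g₀ k), gbar_zero]
  linarith

/-- The same bound for a shifted block: `P_n (1 - (16/9)γB(ḡ_n - ḡ_{n+d})) ≤ P_{n+d}`.
[cite: BauerschmidtBrydgesSlade2015Flow, Lemma 2.1(iii)(a) (c_j - c_{j,l} = O(χ_lḡ_l))] -/
theorem prodFactor_mul_le_prodFactor_add (hγ0 : 0 ≤ γ) (hγ1 : γ ≤ 1) (n d : ℕ) :
    prodFactor β g₀ γ n * (1 - 16 / 9 * γ * B * (gbar β g₀ n - gbar β g₀ (n + d))) ≤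
      prodFactor β g₀ γ (n + d) := by
  rw [prodFactor, prodFactor, prod_range_add]
  refine mul_le_mul_of_nonneg_left ?_ (h.prodFactor_pos hγ1 n).le
  have hW := one_sub_sum_range_le_prod (fun k => stepFactor γ (β (n + k) * gbar β g₀ (n + k))) d
    (fun k _ => (stepFactor_pos (by linarith [h.beta_mul_gbar_le (n + k)])
      (h.gamma_mul_lt_one hγ1 (n + k))).le)
    (fun k _ => stepFactor_le_one (h.beta_mul_gbar_nonneg (n + k))
      (by linarith [h.beta_mul_gbar_le (n + k)]) hγ0 hγ1)
  refine le_trans ?_ hW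
  have hsum : ∑ k ∈ range d, (1 - stepFactor γ (β (n + k) * gbar β g₀ (n + k))) ≤
      16 / 9 * γ * B * (gbar β g₀ n - gbar β g₀ (n + d)) := by
    calc ∑ k ∈ range d, (1 - stepFactor γ (β (n + k) * gbar β g₀ (n + k)))
        ≤ ∑ k ∈ range d, 16 / 9 * γ * B * (gbar β g₀ (n + k) - gbar β g₀ (n + (k + 1))) :=
          sum_le_sum fun k _ => h.one_sub_stepFactor_le hγ0 hγ1 (n + k)
      _ = 16 / 9 * γ * B * (gbar β g₀ n - gbar β g₀ (n + d)) := by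
          rw [← mul_sum, sum_range_sub' (fun k => gbar β g₀ (n + k))]
          simp
  linarith

/-! ### The limit `c = lim P_n` and the printed form of the product formula -/

/-- `{P_n}` is bounded below (by `0`). [folklore] -/
theorem bddBelow_range_prodFactor (hγ1 : γ ≤ 1) : BddBelow (Set.range (prodFactor β g₀ γ)) :=
  ⟨0, by rintro _ ⟨n, rfl⟩; exact (h.prodFactor_pos hγ1 n).le⟩

/-- `c ≤ P_n`. [cite: BauerschmidtBrydgesSlade2015Flow, Lemma 2.1(iii)(a)] -/
theorem prodFactorLim_le (hγ1 : γ ≤ 1) (n : ℕ) : prodFactorLim β g₀ γ ≤ prodFactor β g₀ γ n :=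
  ciInf_le (h.bddBelow_range_prodFactor hγ1) n

/-- `P_n → c`. [cite: BauerschmidtBrydgesSlade2015Flow, Lemma 2.1(iii)(a) (c_j = lim_l c_{j,l})] -/
theorem tendsto_prodFactor (hγ0 : 0 ≤ γ) (hγ1 : γ ≤ 1) :
    Tendsto (prodFactor β g₀ γ) atTop (𝓝 (prodFactorLim β g₀ γ)) :=
  tendsto_atTop_ciInf (h.prodFactor_antitone hγ0 hγ1) (h.bddBelow_range_prodFactor hγ1)

/-- **`c = 1 + O(g₀)`**: `1 - (16/9)γBg₀ ≤ c ≤ 1` (note `(16/9)γBg₀ ≤ 4/9`).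
[cite: BauerschmidtBrydgesSlade2015Flow, Lemma 2.1(iii)(a) (c_j = 1 + O(χ_jḡ_j))]
[cite: BauerschmidtBrydgesSlade2015LogCorr, §8.3 (c_j = 1 + O(χ_jḡ_j) in the product formula)] -/
theorem prodFactorLim_mem (hγ0 : 0 ≤ γ) (hγ1 : γ ≤ 1) :
    prodFactorLim β g₀ γ ∈ Set.Icc (1 - 16 / 9 * γ * B * g₀) 1 := by
  constructor
  · refine le_ciInf fun n => le_trans ?_ (h.one_sub_le_prodFactor hγ0 hγ1 n)
    have : 0 ≤ 16 / 9 * γ * B * gbar β g₀ n :=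
      mul_nonneg (mul_nonneg (by positivity) h.B_nonneg) (h.gbar_pos n).le
    linarith
  · exact (h.prodFactorLim_le hγ1 0).trans (h.prodFactor_le_one hγ0 hγ1 0)

/-- `c > 0` (indeed `c ≥ 5/9`). [folklore] -/
theorem prodFactorLim_pos (hγ0 : 0 ≤ γ) (hγ1 : γ ≤ 1) : 0 < prodFactorLim β g₀ γ := by
  have h1 := (h.prodFactorLim_mem hγ0 hγ1).1
  have h2 : 16 / 9 * γ * B * g₀ ≤ 4 / 9 := by
    have := h.small
    nlinarith [mul_nonneg h.B_nonneg h.pos.le]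
  linarith

/-- **`P_n = c(1 + O(ḡ_n))`**: `c ≤ P_n` and `P_n(1 - (16/9)γBḡ_n) ≤ c`.
[cite: BauerschmidtBrydgesSlade2015Flow, Lemma 2.1(iii)(a) (c_{j,l} = c_j + O(χ_lḡ_l))] -/
theorem prodFactor_mul_le_prodFactorLim (hγ0 : 0 ≤ γ) (hγ1 : γ ≤ 1) (n : ℕ) :
    prodFactor β g₀ γ n * (1 - 16 / 9 * γ * B * gbar β g₀ n) ≤ prodFactorLim β g₀ γ := by
  refine le_ciInf fun m => ?_
  rcases le_or_gt n m with hnm | hmn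
  · obtain ⟨d, rfl⟩ := Nat.exists_eq_add_of_le hnm
    refine le_trans ?_ (h.prodFactor_mul_le_prodFactor_add hγ0 hγ1 n d)
    refine mul_le_mul_of_nonneg_left ?_ (h.prodFactor_pos hγ1 n).le
    have : 0 ≤ 16 / 9 * γ * B * gbar β g₀ (n + d) :=
      mul_nonneg (mul_nonneg (by positivity) h.B_nonneg) (h.gbar_pos (n + d)).le
    linarith
  · calc prodFactor β g₀ γ n * (1 - 16 / 9 * γ * B * gbar β g₀ n)
        ≤ prodFactor β g₀ γ n * 1 := by
          refine mul_le_mul_of_nonneg_left ?_ (h.prodFactor_pos hγ1 n).le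
          have : 0 ≤ 16 / 9 * γ * B * gbar β g₀ n :=
            mul_nonneg (mul_nonneg (by positivity) h.B_nonneg) (h.gbar_pos n).le
          linarith
      _ ≤ prodFactor β g₀ γ m := by rw [mul_one]; exact h.prodFactor_antitone hγ0 hγ1 hmn.le

/-- **The product formula in the printed shape** (`r = 0`, `j = 0`, `0 ≤ γ ≤ 1`):
`(g₀/ḡ_n)^γ c ≤ ∏_{k<n}(1 - γβ_kḡ_k)⁻¹ ≤ (g₀/ḡ_n)^γ c (1 - (16/9)γBḡ_n)⁻¹`, with
`1 - (16/9)γBg₀ ≤ c ≤ 1` (`prodFactorLim_mem`): "`∏_{k=j}^l(1 - γβ_kḡ_k)⁻¹ = (ḡ_j/ḡ_{l+1})^γ(c_j + O(χ_lḡ_l))`,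
`c_j = 1 + O(χ_jḡ_j)`" — the source of the exponent `γ = 1/4` in `μ̌_j' ∼ L^{2j}(ǧ_j/g₀)^γ c`.
[cite: BauerschmidtBrydgesSlade2015Flow, Lemma 2.1(iii)(a)]
[cite: BauerschmidtBrydgesSlade2015LogCorr, §8.3 (the product formula before the third lemma; Π_j in its proof)] -/
theorem prod_inv_one_sub_mem (hγ0 : 0 ≤ γ) (hγ1 : γ ≤ 1) (n : ℕ) :
    ∏ k ∈ range n, (1 - γ * (β k * gbar β g₀ k))⁻¹ ∈
      Set.Icc ((g₀ / gbar β g₀ n) ^ γ * prodFactorLim β g₀ γ)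
        ((g₀ / gbar β g₀ n) ^ γ * prodFactorLim β g₀ γ / (1 - 16 / 9 * γ * B * gbar β g₀ n)) := by
  rw [h.prod_inv_one_sub_eq hγ1 n]
  have hR : 0 ≤ (g₀ / gbar β g₀ n) ^ γ := Real.rpow_nonneg (div_pos h.pos (h.gbar_pos n)).le _
  have hden : 0 < 1 - 16 / 9 * γ * B * gbar β g₀ n := by
    have h2 : 16 / 9 * γ * B * gbar β g₀ n ≤ 4 / 9 := by
      have := h.small
      have := h.gbar_le_init n
      nlinarith [mul_nonneg h.B_nonneg (h.gbar_pos n).le, mul_nonneg h.B_nonneg h.pos.le,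
        mul_le_mul_of_nonneg_left (h.gbar_le_init n) h.B_nonneg]
    linarith
  constructor
  · exact mul_le_mul_of_nonneg_left (h.prodFactorLim_le hγ1 n) hR
  · rw [le_div_iff₀ hden, mul_assoc]
    exact mul_le_mul_of_nonneg_left (h.prodFactor_mul_le_prodFactorLim hγ0 hγ1 n) hR

end GbarHyp

end CTWSAW

end Literature.Barriers.CriticalPhenomena
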